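import Summits.Ventures.Crystal3D.Theorems.StickyWulffConstantCoaxialWallLawPayerInstance
import Summits.Ventures.Crystal3D.Theorems.StickyWulffConstantCoaxialWallLawSources
import Summits.Ventures.Crystal3D.Theorems.StickyWulffConstantCoaxialWallLawBandCount
import Summits.Ventures.Crystal3D.Theorems.StickyWulffConstantCoaxialWallLawTwinFrames
import Summits.Ventures.Crystal3D.Theorems.StickyWulffConstantNoReconstructionGainSymmetry
import HarnessLib

/-!
# End accounting for the word automaton, census-free III: the in-plane twin cell — payers ≥ (√2 α π ρ² − O((1+h)ρ))/78

HONEST FRAMING. Part of the venture `Summits/Ventures/Crystal3D` (cell `crystal3d-full`), helper for the crux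
`CoaxialWallLaw` (stmt-Ventures-19481) of `route-Ventures-StickyWulffConstant`, REGISTERED line `WallLedgerF`
(planner cf-p1), open stub `stub_coaxialTwoSlabAdhesion` (general fillings).  Rung credit only; F-C1 not moved.

The CENSUS-FREE twin cell: the text of `…ExactCell.wordNet_twin_payers_ge_exact` (whose E1 row A12-583 is refuted,
`…GenericWallFloorGlideStarWitness`) with the count `word_sources_le_lists_exact` replaced by the census-free
`word_sources_le_lists_payers` (`…PayerInstance`: ends at unsaturated balls pay there, ends at saturated balls pay
through two unsaturated contact neighbours; `KissingGap δ`, `KissingClassification δ` BY NAME, no `ExactOnly` row):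

**Theorem (`wordNet_twin_payers_ge_censusFree`).**  For a twin pair in normal form (`F false, F true ∈ {L, L∘R_{e₃}}`),
an in-plane slot `ustar` of the bottom frame with vertical component `α = (F false ustar)₂ > 0`, and the two-slab
cell (`R₀ ≥ 10`):

  `√2 α π ρ² − (12√2π + 36R₀ + 55440) ρ ≤ 78 · #{z ∈ X : deg z ≤ 11, −R₀ − 2 ≤ z₂ ≤ h + R₀ + 2}`.

The proof is `…ExactCell`'s verbatim with the constant `22 ↦ 78` and the two rows replaced by the kissing facts.

WHAT THIS IS NOT: not the stub; the twin law (constant `√6/312·sin θ`) is the next file; F-C1 not moved.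
-/
noncomputable section

namespace Summit.Ventures.Crystal3D.Theorems

open Summit.Ventures.Crystal3D Finset
open Literature.MathematicalPhysics.StatisticalMechanics (fccStacking)
open scoped InnerProductSpace

open scoped Classical in
/-- **The CENSUS-FREE in-plane count feeds the payers (co-axial twin cell, normal form).**  See the module docstring. -/
theorem wordNet_twin_payers_ge_censusFree {δ : ℝ} (hg : KissingGap δ) (hc : KissingClassification δ)
    (L : EuclideanSpace ℝ (Fin 3) ≃ₗᵢ[ℝ] EuclideanSpace ℝ (Fin 3))
    (F : Bool → (EuclideanSpace ℝ (Fin 3) ≃ₗᵢ[ℝ] EuclideanSpace ℝ (Fin 3)))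
    (hF : (F false = L ∧ F true = (ℝ ∙ EuclideanSpace.single (2 : Fin 3) (1 : ℝ)).reflection.trans L) ∨
      (F false = (ℝ ∙ EuclideanSpace.single (2 : Fin 3) (1 : ℝ)).reflection.trans L ∧ F true = L))
    {n : EuclideanSpace ℝ (Fin 3)}
    (hn : n = L (EuclideanSpace.single (2 : Fin 3) (1 : ℝ)) ∨ n = -L (EuclideanSpace.single (2 : Fin 3) (1 : ℝ)))
    {ustar : EuclideanSpace ℝ (Fin 3)} (hustar : ustar ∈ fccSlots) (hinp : ⟪F false ustar, n⟫_ℝ = 0)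
    (hα₁ : 0 < (F false ustar) 2)
    (s₁ s₂ : EuclideanSpace ℝ (Fin 3)) (X P₁ P₂ : Finset (EuclideanSpace ℝ (Fin 3))) (R₀ h ρ : ℝ)
    (hR₀ : 10 ≤ R₀) (hh : 0 ≤ h) (hρ : R₀ ≤ ρ)
    (hX : ∀ p ∈ X, ∀ q ∈ X, p ≠ q → 1 ≤ dist p q)
    (hcell : ∀ p ∈ X, -(2 * R₀) ≤ p 2 ∧ p 2 ≤ h + 2 * R₀ ∧ p 0 ^ 2 + p 1 ^ 2 ≤ ρ ^ 2)
    (hP₁X : P₁ ⊆ X) (hP₂X : P₂ ⊆ X)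
    (hP₁ : ∀ p, p ∈ P₁ ↔ (p ∈ (fun q => F false q + s₁) '' fccStacking 1 (Real.sqrt (2 / 3)) ∧
      -(2 * R₀) ≤ p 2 ∧ p 2 ≤ -R₀ ∧ p 0 ^ 2 + p 1 ^ 2 ≤ ρ ^ 2))
    (hP₂ : ∀ p, p ∈ P₂ ↔ (p ∈ (fun q => F true q + s₂) '' fccStacking 1 (Real.sqrt (2 / 3)) ∧
      h + R₀ ≤ p 2 ∧ p 2 ≤ h + 2 * R₀ ∧ p 0 ^ 2 + p 1 ^ 2 ≤ ρ ^ 2)) :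
    Real.sqrt 2 * (F false ustar) 2 * Real.pi * ρ ^ 2 - (12 * Real.sqrt 2 * Real.pi + 36 * R₀ + 55440) * ρ ≤
      78 * ((X.filter fun z => (X.filter fun q => dist z q = 1).card ≤ 11 ∧
          -R₀ - 2 ≤ z 2 ∧ z 2 ≤ h + R₀ + 2).card : ℝ) := by
  set e₃ : EuclideanSpace ℝ (Fin 3) := EuclideanSpace.single (2 : Fin 3) (1 : ℝ) with he₃
  set RL := (ℝ ∙ EuclideanSpace.single (2 : Fin 3) (1 : ℝ)).reflection.trans L with hRL
  have hr : 0 < Real.sqrt (2 / 3) := Real.sqrt_pos.2 (by norm_num)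
  have hR₀3 : (3 : ℝ) ≤ R₀ := by linarith
  have hρ0 : (0 : ℝ) ≤ ρ := by linarith
  have hρ1 : (1 : ℝ) ≤ ρ := by linarith
  -- the axis: unit, and the menu of both frames along it
  have hn1 : ‖n‖ = 1 := by
    rcases hn with rfl | rfl
    · rw [LinearIsometryEquiv.norm_map, he₃, PiLp.norm_single, norm_one]
    · rw [norm_neg, LinearIsometryEquiv.norm_map, he₃, PiLp.norm_single, norm_one]
  have hax : ∀ c w, ⟪F c w, L e₃⟫_ℝ = w 2 := by
    intro c w
    rcases hF with ⟨h0, h1⟩ | ⟨h0, h1⟩ <;> cases c <;> simp only [h0, h1]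
    · exact inner_frame_axis L w
    · exact inner_twinFrame_axis L w
    · exact inner_twinFrame_axis L w
    · exact inner_frame_axis L w
  have haxn : ∀ c w, ⟪F c w, n⟫_ℝ = w 2 ∨ ⟪F c w, n⟫_ℝ = -w 2 := by
    intro c w
    rcases hn with rfl | rfl
    · exact Or.inl (hax c w)
    · exact Or.inr (by rw [inner_neg_right, hax])
  have hmenu : ∀ c, ∀ w ∈ fccSlots,
      ⟪F c w, n⟫_ℝ = 0 ∨ ⟪F c w, n⟫_ℝ = Real.sqrt (2 / 3) ∨ ⟪F c w, n⟫_ℝ = -Real.sqrt (2 / 3) := by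
    intro c w hw
    rcases haxn c w with h | h <;> rcases slot_apply_two_cases hw with h' | h' | h' <;> rw [h, h']
    · exact Or.inl rfl
    · exact Or.inr (Or.inl rfl)
    · exact Or.inr (Or.inr rfl)
    · exact Or.inl neg_zero
    · exact Or.inr (Or.inr rfl)
    · exact Or.inr (Or.inl (neg_neg _))
  -- the top frame is the mirror of the bottom frame composed with `−1`
  have htrue : ∀ w, F true (-w) = F false w - (2 * ⟪F false w, n⟫_ℝ) • n := by
    intro w
    rcases hF with ⟨h0, h1⟩ | ⟨h0, h1⟩ <;> rw [h0, h1]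
    · exact twinFrame_neg_eq L hn w
    · exact frame_neg_eq L hn w
  -- the word data over the bottom frame
  set Fw : List (EuclideanSpace ℝ (Fin 3)) → (EuclideanSpace ℝ (Fin 3) ≃ₗᵢ[ℝ] EuclideanSpace ℝ (Fin 3)) :=
    fun κ => κ.foldr (fun μ G => ((ℝ ∙ μ)ᗮ.reflection).trans G) (F false) with hFw
  set uw : List (EuclideanSpace ℝ (Fin 3)) → EuclideanSpace ℝ (Fin 3) := fun κ => κ.foldr (fun _ v => -v) ustar
    with huw
  set WFw : List (EuclideanSpace ℝ (Fin 3)) → Prop := fun κ =>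
    List.rec (motive := fun _ => Prop) True (fun μ κ' ih => ih ∧ ‖μ‖ = 1 ∧
      (∀ w ∈ fccSlots, ⟪w, μ⟫_ℝ = 0 ∨ ⟪w, μ⟫_ℝ = Real.sqrt (2 / 3) ∨ ⟪w, μ⟫_ℝ = -Real.sqrt (2 / 3)) ∧
      ⟪uw κ', μ⟫_ℝ = Real.sqrt (2 / 3) ∧ ∀ μ' κ'', κ' = μ' :: κ'' → μ' ≠ -μ) κ with hWFw
  set nextw : List (EuclideanSpace ℝ (Fin 3)) → EuclideanSpace ℝ (Fin 3) → List (EuclideanSpace ℝ (Fin 3)) :=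
    fun κ m => @ite _ (∃ μ κ', κ = μ :: κ' ∧ (Fw κ).symm m = -μ) (Classical.propDecidable _) κ.tail
      ((Fw κ).symm m :: κ) with hnextw
  have hF0 : Fw [] = F false := rfl
  have hFc : ∀ μ κ, Fw (μ :: κ) = ((ℝ ∙ μ)ᗮ.reflection).trans (Fw κ) := fun _ _ => rfl
  have hu0 : uw [] = ustar := rfl
  have huc : ∀ μ κ, uw (μ :: κ) = -uw κ := fun _ _ => rfl
  have hWF0 : WFw [] := trivial
  have hWFc : ∀ μ κ, WFw (μ :: κ) ↔ (WFw κ ∧ ‖μ‖ = 1 ∧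
      (∀ w ∈ fccSlots, ⟪w, μ⟫_ℝ = 0 ∨ ⟪w, μ⟫_ℝ = Real.sqrt (2 / 3) ∨ ⟪w, μ⟫_ℝ = -Real.sqrt (2 / 3)) ∧
      ⟪uw κ, μ⟫_ℝ = Real.sqrt (2 / 3) ∧ ∀ μ' κ', κ = μ' :: κ' → μ' ≠ -μ) := fun _ _ => Iff.rfl
  have hnext_pop : ∀ μ κ' (m : EuclideanSpace ℝ (Fin 3)), (Fw (μ :: κ')).symm m = -μ → nextw (μ :: κ') m = κ' := by
    intro μ κ' m hν
    simp only [hnextw]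
    rw [if_pos ⟨μ, κ', rfl, hν⟩, List.tail_cons]
  have hnext_push : ∀ κ (m : EuclideanSpace ℝ (Fin 3)), (∀ μ κ', κ = μ :: κ' → (Fw κ).symm m ≠ -μ) →
      nextw κ m = (Fw κ).symm m :: κ := by
    intro κ m hnp
    simp only [hnextw]
    rw [if_neg]
    rintro ⟨μ, κ', h, hν⟩
    exact hnp μ κ' h hν
  clear_value nextw WFw uw Fw
  have hu : ∀ κ, uw κ ∈ fccSlots := word_u_mem hustar hu0 huc
  -- the model lamination normal `ν₀ = (F false)⁻¹ n` and the top frame `Fw [ν₀] = R_n ∘ F false`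
  set ν₀ : EuclideanSpace ℝ (Fin 3) := (Fw []).symm n with hν₀
  have hFν₀ : Fw [] ν₀ = n := by rw [hν₀, LinearIsometryEquiv.apply_symm_apply]
  have hν₀1 : ‖ν₀‖ = 1 := by rw [hν₀, LinearIsometryEquiv.norm_map, hn1]
  have hinner0 : ∀ x, ⟪x, ν₀⟫_ℝ = ⟪Fw [] x, n⟫_ℝ := by
    intro x; rw [← hFν₀, LinearIsometryEquiv.inner_map_map]
  have hν₀menu : ∀ w ∈ fccSlots, ⟪w, ν₀⟫_ℝ = 0 ∨ ⟪w, ν₀⟫_ℝ = Real.sqrt (2 / 3) ∨ ⟪w, ν₀⟫_ℝ = -Real.sqrt (2 / 3) := by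
    intro w hw; rw [hinner0, hF0]; exact hmenu false w hw
  have horth : ⟪uw [], ν₀⟫_ℝ = 0 := by rw [hinner0, hF0, hu0]; exact hinp
  have hlamF : ∀ x, Fw [ν₀] x = F false x - (2 * ⟪F false x, n⟫_ℝ) • n := by
    intro x
    have := word_push_frame hFc [] hn1 x
    rw [hF0] at this
    rw [hν₀, hF0]
    exact this
  have hG₂ : ((Fw [ν₀] : EuclideanSpace ℝ (Fin 3) ≃ₗᵢ[ℝ] EuclideanSpace ℝ (Fin 3)) :
      EuclideanSpace ℝ (Fin 3) → EuclideanSpace ℝ (Fin 3)) '' ↑fccSlots =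
      (fun x => Fw [] (x - (2 * ⟪x, ν₀⟫_ℝ) • ν₀)) '' ↑fccSlots := by
    refine Set.image_congr fun x _ => ?_
    exact word_F_cons_apply hFc hν₀1 [] x
  have htrue' : ∀ y, F true y = Fw [ν₀] (-y) := by
    intro y
    rw [hlamF]
    have := htrue (-y)
    rw [neg_neg] at this
    exact this
  have hΛ₂ : (fun q => F true q + s₂) '' fccStacking 1 (Real.sqrt (2 / 3)) =
      (fun q => Fw [ν₀] q + s₂) '' fccStacking 1 (Real.sqrt (2 / 3)) := by
    ext p
    constructor
    · rintro ⟨q, hq, rfl⟩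
      exact ⟨-q, fcc_neg_mem hq, by simp only [htrue']⟩
    · rintro ⟨q, hq, rfl⟩
      refine ⟨-q, fcc_neg_mem hq, ?_⟩
      simp only [htrue', neg_neg]
  have hP₂' : ∀ p, p ∈ P₂ ↔ (p ∈ (fun q => Fw [ν₀] q + s₂) '' fccStacking 1 (Real.sqrt (2 / 3)) ∧
      h + R₀ ≤ p 2 ∧ p 2 ≤ h + 2 * R₀ ∧ p 0 ^ 2 + p 1 ^ 2 ≤ ρ ^ 2) := by
    intro p; rw [hP₂, hΛ₂]
  -- the inner sample
  set zcut : ℝ := h + R₀ + 1 with hzcut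
  set P' : Finset (EuclideanSpace ℝ (Fin 3)) := P₁.filter fun p =>
    -(2 * R₀) + 1 ≤ p 2 ∧ p 2 ≤ -R₀ - 1 ∧ p 0 ^ 2 + p 1 ^ 2 ≤ (ρ - 1) ^ 2 with hP'def
  have hP'iff : ∀ p, p ∈ P' ↔ (p ∈ (fun q => F false q + s₁) '' fccStacking 1 (Real.sqrt (2 / 3)) ∧
      -(2 * R₀) + 1 ≤ p 2 ∧ p 2 ≤ -R₀ - 1 ∧ p 0 ^ 2 + p 1 ^ 2 ≤ (ρ - 1) ^ 2) := by
    intro p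
    rw [hP'def, mem_filter, hP₁]
    constructor
    · rintro ⟨⟨hΛ, -, -, -⟩, h1, h2, h3⟩; exact ⟨hΛ, h1, h2, h3⟩
    · rintro ⟨hΛ, h1, h2, h3⟩
      have hρ1' : (0 : ℝ) ≤ ρ - 1 := by linarith
      exact ⟨⟨hΛ, by linarith, by linarith, by nlinarith⟩, h1, h2, h3⟩
  -- the inner sample has full shells (complete sample)
  have hP'full : ∀ p ∈ P', ∀ w ∈ fccSlots, p + Fw [] w ∈ X := by
    intro p hp w hw
    rw [hF0]
    obtain ⟨hΛ, h1, h2, h3⟩ := (hP'iff p).1 hp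
    apply hP₁X
    rw [hP₁]
    have hw2 : |(F false w) 2| ≤ 1 := by rw [apply_two_eq_inner_e₃]; exact abs_inner_slot_le_one (F false) hw
    obtain ⟨hw2a, hw2b⟩ := abs_le.1 hw2
    refine ⟨movedFcc_add_site_mem (F false) s₁ hΛ (mem_fcc_of_mem_fccSlots hw), ?_, ?_, ?_⟩
    · show -(2 * R₀) ≤ (p + F false w) 2
      rw [PiLp.add_apply]; linarith
    · show (p + F false w) 2 ≤ -R₀
      rw [PiLp.add_apply]; linarith
    · show (p + F false w) 0 ^ 2 + (p + F false w) 1 ^ 2 ≤ ρ ^ 2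
      have hρ1' : (0 : ℝ) ≤ ρ - 1 := by linarith
      have hsl : Real.sqrt (p 0 ^ 2 + p 1 ^ 2) ≤ ρ - 1 := by
        rw [← Real.sqrt_sq hρ1']; exact Real.sqrt_le_sqrt h3
      have e1 := sqrt_lateral_add_le p (F false w)
      rw [LinearIsometryEquiv.norm_map, norm_eq_one_of_mem_fccSlots hw] at e1
      have e3 : Real.sqrt ((p + F false w) 0 ^ 2 + (p + F false w) 1 ^ 2) ≤ ρ := by linarith
      have e4 := Real.sq_sqrt (by positivity : (0 : ℝ) ≤ (p + F false w) 0 ^ 2 + (p + F false w) 1 ^ 2)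
      have e5 : (0 : ℝ) ≤ Real.sqrt ((p + F false w) 0 ^ 2 + (p + F false w) 1 ^ 2) := Real.sqrt_nonneg _
      nlinarith
  -- (1) the NET count of the word automaton
  have hup : 0 < (Fw [] (uw [])) 2 := by rw [hF0, hu0]; exact hα₁
  have hP₁' : ∀ p, p ∈ P₁ ↔ (p ∈ (fun q => Fw [] q + s₁) '' fccStacking 1 (Real.sqrt (2 / 3)) ∧
      -(2 * R₀) ≤ p 2 ∧ p 2 ≤ -R₀ ∧ p 0 ^ 2 + p 1 ^ 2 ≤ ρ ^ 2) := by rw [hF0]; exact hP₁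
  have hP'iff' : ∀ p, p ∈ P' ↔ (p ∈ (fun q => Fw [] q + s₁) '' fccStacking 1 (Real.sqrt (2 / 3)) ∧
      -(2 * R₀) + 1 ≤ p 2 ∧ p 2 ≤ -R₀ - 1 ∧ p 0 ^ 2 + p 1 ^ 2 ≤ (ρ - 1) ^ 2) := by rw [hF0]; exact hP'iff
  have hcore := word_sources_le_lists_payers (F := Fw) (u := uw) (WF := WFw) (next := nextw) (t₁ := s₁) (t₂ := s₂)
    hg hc hX hFc hu huc hWF0 hWFc hnext_pop hnext_push hν₀1 hν₀menu horth (Fw [ν₀]) hG₂ hup hR₀3 hρ hcell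
    hP₁X hP₂X hP₁' hP'iff' hP'full hP₂'
  rw [hF0, hu0] at hcore
  -- (2) the sources
  have hsources := card_vertical_tops_ge (F false) s₁ X P₁ P' R₀ ρ zcut hR₀3 hρ (by rw [hzcut]; linarith)
    hX hP₁X hP₁ hP'iff hustar (by rw [← apply_two_eq_inner_e₃]; exact hα₁.le)
  -- (3) the rims
  set RIMT := X.filter fun s => zcut ≤ s 2 ∧ s 2 ≤ zcut + 1 ∧ (ρ - 2) ^ 2 < s 0 ^ 2 + s 1 ^ 2 with hRIMT
  have hrimT : (RIMT.card : ℝ) ≤ 144 * ρ := by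
    have hsep : ∀ p ∈ RIMT, ∀ q ∈ RIMT, p ≠ q → 1 ≤ dist p q :=
      fun p hp q hq hpq => hX p (mem_filter.1 hp).1 q (mem_filter.1 hq).1 hpq
    have hmem : ∀ p ∈ RIMT, zcut ≤ p 2 ∧ p 2 ≤ zcut + 1 ∧ (ρ - 2) ^ 2 < p 0 ^ 2 + p 1 ^ 2 ∧
        p 0 ^ 2 + p 1 ^ 2 ≤ ρ ^ 2 := by
      intro p hp
      obtain ⟨hpX, h1, h2, h3⟩ := mem_filter.1 hp
      exact ⟨h1, h2, h3, (hcell p hpX).2.2⟩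
    have key := card_mul_le_of_separated_in_shell RIMT hsep zcut (zcut + 1) (ρ - 2) ρ (by linarith)
      (by linarith) (by linarith) hmem
    have e : (zcut + 1 - zcut + 2) * (Real.pi * (ρ + 1) ^ 2 - Real.pi * (ρ - 2 - 1) ^ 2) =
        (Real.pi / 6) * (144 * ρ - 144) := by ring
    rw [e] at key
    have hπ : 0 < Real.pi / 6 := by positivity
    have := le_of_mul_le_mul_right (by linarith [key] : (RIMT.card : ℝ) * (Real.pi / 6) ≤
      (144 * ρ - 144) * (Real.pi / 6)) hπ
    linarith
  set RIMB := X.filter fun s => -R₀ - 1 - 1 ≤ s 2 ∧ s 2 < -R₀ - 1 ∧ (ρ - 1) ^ 2 < s 0 ^ 2 + s 1 ^ 2 with hRIMB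
  have hrimB : (RIMB.card : ℝ) ≤ 108 * ρ := by
    have hsep : ∀ p ∈ RIMB, ∀ q ∈ RIMB, p ≠ q → 1 ≤ dist p q :=
      fun p hp q hq hpq => hX p (mem_filter.1 hp).1 q (mem_filter.1 hq).1 hpq
    have hmem : ∀ p ∈ RIMB, -R₀ - 1 - 1 ≤ p 2 ∧ p 2 ≤ -R₀ - 1 ∧ (ρ - 1) ^ 2 < p 0 ^ 2 + p 1 ^ 2 ∧
        p 0 ^ 2 + p 1 ^ 2 ≤ ρ ^ 2 := by
      intro p hp
      obtain ⟨hpX, h1, h2, h3⟩ := mem_filter.1 hp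
      exact ⟨h1, h2.le, h3, (hcell p hpX).2.2⟩
    have key := card_mul_le_of_separated_in_shell RIMB hsep (-R₀ - 1 - 1) (-R₀ - 1) (ρ - 1) ρ (by linarith)
      (by linarith) (by linarith) hmem
    have e : (-R₀ - 1 - (-R₀ - 1 - 1) + 2) * (Real.pi * (ρ + 1) ^ 2 - Real.pi * (ρ - 1 - 1) ^ 2) =
        (Real.pi / 6) * (108 * ρ - 54) := by ring
    rw [e] at key
    have hπ : 0 < Real.pi / 6 := by positivity
    have := le_of_mul_le_mul_right (by linarith [key] : (RIMB.card : ℝ) * (Real.pi / 6) ≤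
      (108 * ρ - 54) * (Real.pi / 6)) hπ
    linarith
  -- (4) arithmetic
  set α₁ := (F false ustar) 2 with hα₁def
  set PAY := X.filter fun z => (X.filter fun q => dist z q = 1).card ≤ 11 ∧ -R₀ - 2 ≤ z 2 ∧ z 2 ≤ h + R₀ + 2
    with hPAY
  have hα₁' : ⟪F false ustar, EuclideanSpace.single (2 : Fin 3) (1 : ℝ)⟫_ℝ = α₁ := (apply_two_eq_inner_e₃ _).symm
  have hα₁le : α₁ ≤ 1 := by
    rw [← hα₁']; exact (abs_le.1 (abs_inner_slot_le_one (F false) hustar)).2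
  rw [hα₁', abs_of_pos hα₁] at hsources
  -- identify the payer window of the core with `PAY`
  have hPAYeq : (X.filter fun z => (X.filter fun q => dist z q = 1).card ≤ 11 ∧
      -R₀ - 1 - 1 ≤ z 2 ∧ z 2 ≤ h + R₀ + 1 + 1) = PAY := by
    refine filter_congr fun z _ => ?_
    rw [show -R₀ - 1 - 1 = -R₀ - 2 by ring, show h + R₀ + 1 + 1 = h + R₀ + 2 by ring]
  rw [hPAYeq] at hcore
  -- the core count, cast to `ℝ`
  have hcast : ((P'.filter fun p => (∀ w ∈ fccSlots, p + F false w ∈ X) ∧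
      -R₀ - 1 < (p + F false ustar) 2 ∧ (p + F false ustar) 2 < zcut).card : ℝ) ≤
      78 * (PAY.card : ℝ) + 220 * (RIMT.card : ℝ) + 220 * (RIMB.card : ℝ) := by
    have h0 : (P'.filter fun p => (∀ w ∈ fccSlots, p + F false w ∈ X) ∧
        -R₀ - 1 < (p + F false ustar) 2 ∧ (p + F false ustar) 2 < zcut).card ≤
        78 * PAY.card + 220 * RIMT.card + 220 * RIMB.card := hcore
    exact_mod_cast h0
  have hsrc' : Real.sqrt 2 * α₁ * Real.pi * (ρ - 1) ^ 2 - 10 * Real.sqrt 2 * Real.pi * (ρ - 1) - 36 * R₀ * ρ ≤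
      ((P'.filter fun p => (∀ w ∈ fccSlots, p + F false w ∈ X) ∧
        -R₀ - 1 < (p + F false ustar) 2 ∧ (p + F false ustar) 2 < zcut).card : ℝ) := by
    convert hsources using 4
  have h2 : 0 ≤ Real.sqrt 2 := Real.sqrt_nonneg _
  have hπ : 0 ≤ Real.pi := Real.pi_pos.le
  have hsq : Real.sqrt 2 * α₁ * Real.pi * (ρ - 1) ^ 2 ≥ Real.sqrt 2 * α₁ * Real.pi * ρ ^ 2 - 2 * Real.sqrt 2 * Real.pi * ρ := by
    have hα₁0 : 0 ≤ α₁ := hα₁.le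
    have : Real.sqrt 2 * α₁ * Real.pi * (ρ - 1) ^ 2 = Real.sqrt 2 * α₁ * Real.pi * ρ ^ 2 -
        2 * Real.sqrt 2 * α₁ * Real.pi * ρ + Real.sqrt 2 * α₁ * Real.pi := by ring
    rw [this]
    have h1 : Real.sqrt 2 * α₁ * Real.pi * ρ ≤ Real.sqrt 2 * Real.pi * ρ := by
      have := mul_le_mul_of_nonneg_left hα₁le (by positivity : 0 ≤ Real.sqrt 2 * Real.pi * ρ)
      have e1 : Real.sqrt 2 * α₁ * Real.pi * ρ = Real.sqrt 2 * Real.pi * ρ * α₁ := by ring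
      rw [mul_one] at this; rw [e1]; exact this
    have h3 : 0 ≤ Real.sqrt 2 * α₁ * Real.pi := mul_nonneg (mul_nonneg h2 hα₁0) hπ
    linarith
  have h2π : 0 ≤ Real.sqrt 2 * Real.pi * ρ := mul_nonneg (mul_nonneg h2 hπ) hρ0
  have h10 : 10 * Real.sqrt 2 * Real.pi * (ρ - 1) ≤ 10 * Real.sqrt 2 * Real.pi * ρ := by nlinarith only [h2π, h2, hπ]
  linarith only [hcast, hsrc', hrimT, hrimB, hsq, h10, h2π]

end Summit.Ventures.Crystal3D.Theorems

end
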